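import Summits.CriticalPhenomena.PercolationContinuityZ3.Theorems.SahiMasterFamilySparseEndCores
import Summits.CriticalPhenomena.PercolationContinuityZ3.Theorems.SahiMasterFamilyRepresentativeForm

/-!
# The sparse end of Sahi's hierarchy, V: systems of disjoint representatives — `Λ'(F) = N_{goodBlocks}(𝟙) ≥ 0` in map language

Support file of the master-family programme (crux `NoHeavyLowerTail`, stmt-CriticalPhenomena-4575; cell `prim-masterthm`, seat P4,
unit `prim-masterthm-p4-g4`).  Seat document PROOF-SPARSE-END.md §1–2.  Pure finite combinatorics.

The leading sparse coefficient of Sahi's `E_k` arrives (via the representative form `SahiMasterFamilyRepresentativeForm`) as a signed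
sum over SYSTEMS OF REPRESENTATIVES `γ : Fin k → Finset β` (slot `i` represented by the configuration `γ i ∈ F i`) whose distinct
values are pairwise disjoint and cover the minimum configuration `c`, with weight `(−1)^{r+1} ∏_{a ∈ im γ} (occ γ a − 1)!`
(`r = |im γ|`, `occ` = multiplicity; `SahiRepresentativeForm.occ`).  This file proves, for families `F` up-closed inside `2^c` with
`⋂ F_i ∩ 2^c = {c}` and `∅ ∉ F_i`:

* `fib` — the fibre partition of a system; `eq_coreMap_of_mem_systems` (the split lemma in map language: an admissible system is
  the CORE MAP `i ↦ core F c (block of i)` of its fibre partition, and all fibres are good blocks); `coreMap_mem_systems` (conversely);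
* `card_systems_fib_eq` — so the number of admissible systems with a given fibre partition `ρ` is `1` if `ρ ⊆ goodBlocks` and `0` otherwise;
* **`LambdaSys_eq_N`, `LambdaSys_nonneg`** — `Λ'(F) := Σ_{admissible γ} (−1)^{r+1} ∏ (occ−1)! = N_{goodBlocks}(𝟙) ≥ 0`
  (`SahiSparseEnd.N_nonneg`).
What remains for the `E_k`-level statement (future work): `E_k(μ_p;U) = p^m · Ẽ(p)` with `Ẽ(0) = Σ_c w^c Λ'(F^{(c)})` (algebra on the
representative form).  HONEST FRAMING: elementary; [this work].
-/

namespace Summit.CriticalPhenomena.PercolationContinuityZ3.Theorems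

namespace SahiSparseEnd

open Finset SahiRepresentativeForm

variable {β : Type*} [DecidableEq β] {k : ℕ}

/-! ### Systems of disjoint representatives and their fibre partitions -/

/-- Admissible systems for `(F, c)`: `γ i ∈ F i`, distinct values pairwise disjoint, values covering exactly `c`. [this work] -/
def systems (F : Fin k → Finset (Finset β)) (c : Finset β) : Finset (Fin k → Finset β) :=
  (Fintype.piFinset F).filter fun γ => (∀ i j, γ i = γ j ∨ Disjoint (γ i) (γ j)) ∧ univ.biUnion γ = c

omit [DecidableEq β] in
/-- Membership in `systems`. [this work] -/
theorem mem_systems [DecidableEq β] {F : Fin k → Finset (Finset β)} {c : Finset β} {γ : Fin k → Finset β} :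
    γ ∈ systems F c ↔ (∀ i, γ i ∈ F i) ∧ (∀ i j, γ i = γ j ∨ Disjoint (γ i) (γ j)) ∧ univ.biUnion γ = c := by
  rw [systems, mem_filter, Fintype.mem_piFinset]

/-- The fibre of slot `i` under `γ`. [this work] -/
def fiber (γ : Fin k → Finset β) (i : Fin k) : Finset (Fin k) := univ.filter fun j => γ j = γ i

/-- The fibre partition of `γ`. [this work] -/
def fib (γ : Fin k → Finset β) : Finset (Finset (Fin k)) := univ.image (fiber γ)

omit [DecidableEq β] in
/-- Membership in a fibre. [this work] -/
theorem mem_fiber [DecidableEq β] {γ : Fin k → Finset β} {i j : Fin k} : j ∈ fiber γ i ↔ γ j = γ i := by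
  simp [fiber]

omit [DecidableEq β] in
/-- The fibre partition is a set partition of the slots. [this work] -/
theorem fib_mem_parts [DecidableEq β] (γ : Fin k → Finset β) : fib γ ∈ parts (univ : Finset (Fin k)) := by
  rw [mem_parts]
  refine ⟨fun T hT => ?_, fun T hT T' hT' hne => ?_, fun i _ => ⟨fiber γ i, mem_image_of_mem _ (mem_univ i), mem_fiber.2 rfl⟩⟩
  · obtain ⟨i, -, rfl⟩ := mem_image.1 hT
    exact ⟨⟨i, mem_fiber.2 rfl⟩, subset_univ _⟩
  · obtain ⟨i, -, rfl⟩ := mem_image.1 hT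
    obtain ⟨i', -, rfl⟩ := mem_image.1 hT'
    refine disjoint_left.2 fun j hj hj' => hne ?_
    rw [mem_fiber] at hj hj'
    ext x
    rw [mem_fiber, mem_fiber, ← hj, ← hj']

omit [DecidableEq β] in
/-- The block of `i` in the fibre partition is the fibre of `i`. [this work] -/
theorem blockOf_fib [DecidableEq β] (γ : Fin k → Finset β) (i : Fin k) : blockOf (fib γ) i = fiber γ i :=
  (eq_blockOf (fib_mem_parts γ) (mem_univ i) (mem_image_of_mem _ (mem_univ i)) (mem_fiber.2 rfl)).symm

/-! ### The split lemma in map language -/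

section Structure

variable {F : Fin k → Finset (Finset β)} {c : Finset β}
  (hup : ∀ i a a', a ∈ F i → a ⊆ a' → a' ⊆ c → a' ∈ F i)
  (hcap : ∀ a : Finset β, a ⊆ c → ((∀ i, a ∈ F i) ↔ a = c))
  (hne : ∀ i, ∅ ∉ F i)

/-- The core map of a slot partition: slot `i` ↦ the core of its block. [this work] -/
def coreMap (F : Fin k → Finset (Finset β)) (c : Finset β) (ρ : Finset (Finset (Fin k))) : Fin k → Finset β :=
  fun i => core F c (blockOf ρ i)

include hup hcap in
/-- **Split lemma (map language)**: an admissible system is the core map of its fibre partition, and its fibres are good blocks.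
[this work] -/
theorem eq_coreMap_of_mem_systems {γ : Fin k → Finset β} (hγ : γ ∈ systems F c) :
    γ = coreMap F c (fib γ) ∧ fib γ ⊆ goodBlocks F c := by
  obtain ⟨hF, hdis, hcov⟩ := mem_systems.1 hγ
  have hγc : ∀ i, γ i ⊆ c := fun i => hcov ▸ subset_biUnion_of_mem γ (mem_univ i)
  -- `γ i ∈ F_{fiber i}`
  have hγFR : ∀ i, γ i ∈ FR F c (fiber γ i) := fun i =>
    mem_FR.2 ⟨hγc i, fun j hj => (mem_fiber.1 hj) ▸ hF j⟩
  -- the complement of `γ i` inside `c` is in `F_j` for every `j ∉ fiber i`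
  have hcompl : ∀ i j, j ∉ fiber γ i → c \ γ i ∈ F j := by
    intro i j hj
    have hji : γ j ≠ γ i := fun e => hj (mem_fiber.2 e)
    have hdj : Disjoint (γ j) (γ i) := (hdis j i).resolve_left hji
    exact hup j (γ j) _ (hF j) (fun x hx => mem_sdiff.2 ⟨hγc j hx, fun hx' => disjoint_left.1 hdj hx hx'⟩) sdiff_subset
  -- key: `γ i = core (fiber i)`
  have hcore : ∀ i, γ i = core F c (fiber γ i) := by
    intro i
    refine subset_antisymm (fun x hx => mem_core.2 ⟨hγc i hx, fun a' ha' => ?_⟩) (core_subset_of_mem (hγFR i))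
    have ha'c := (mem_FR.1 ha').1
    have hall : ∀ j, a' ∪ (c \ γ i) ∈ F j := by
      intro j
      by_cases hj : j ∈ fiber γ i
      · exact hup j a' _ ((mem_FR.1 ha').2 j hj) subset_union_left (union_subset ha'c sdiff_subset)
      · exact hup j _ _ (hcompl i j hj) subset_union_right (union_subset ha'c sdiff_subset)
    have huniv := (hcap _ (union_subset ha'c sdiff_subset)).1 hall
    have hxu : x ∈ a' ∪ (c \ γ i) := by rw [huniv]; exact hγc i hx
    rcases mem_union.1 hxu with h | h
    · exact h
    · exact absurd hx (mem_sdiff.1 h).2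
  refine ⟨funext fun i => by rw [coreMap, blockOf_fib]; exact hcore i, fun R hR => ?_⟩
  obtain ⟨i, -, rfl⟩ := mem_image.1 hR
  refine mem_goodBlocks.2 ⟨⟨i, mem_fiber.2 rfl⟩, (hcore i) ▸ hγFR i, fun i' hi' j hj => ?_⟩
  have h1 : core F c {i'} ⊆ γ i := (core_mono (singleton_subset_iff.2 hi')).trans (hcore i).symm.subset
  have h2 : core F c {j} ⊆ γ j :=
    (core_mono (singleton_subset_iff.2 (mem_fiber.2 rfl : j ∈ fiber γ j))).trans (hcore j).symm.subset
  have hji : γ j ≠ γ i := fun e => hj (mem_fiber.2 e)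
  exact ((hdis i j).resolve_left (fun e => hji e.symm)).mono h1 h2

include hup hne in
/-- Distinct good blocks of a partition have disjoint, nonempty, hence distinct cores. [this work] -/
theorem core_disjoint_of_good {ρ : Finset (Finset (Fin k))} (hρ : ρ ∈ parts (univ : Finset (Fin k)))
    (hgood : ρ ⊆ goodBlocks F c) {R R' : Finset (Fin k)} (hR : R ∈ ρ) (hR' : R' ∈ ρ) (hRR' : R ≠ R') :
    Disjoint (core F c R) (core F c R') ∧ core F c R ≠ core F c R' := by
  have hparts := mem_parts.1 hρ
  have hdis : Disjoint (core F c R) (core F c R') := by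
    rw [core_eq_biUnion hup R (hparts.1 R hR).1, core_eq_biUnion hup R' (hparts.1 R' hR').1, disjoint_biUnion_left]
    intro i hi
    rw [disjoint_biUnion_right]
    intro j hj
    exact (mem_goodBlocks.1 (hgood hR)).2.2 i hi j fun h => disjoint_left.1 (hparts.2.1 R hR R' hR' hRR') h hj
  refine ⟨hdis, fun e => ?_⟩
  have hmem := (mem_goodBlocks.1 (hgood hR)).2.1
  obtain ⟨i, hi⟩ := (hparts.1 R hR).1
  have hneR : core F c R ≠ ∅ := fun h => hne i (h ▸ (mem_FR.1 hmem).2 i hi)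
  rw [e] at hdis hneR
  exact hneR (disjoint_self.1 hdis)

include hup hcap hne in
/-- Conversely, the core map of a partition into good blocks is an admissible system with that fibre partition (`k ≥ 1`). [this work] -/
theorem coreMap_mem_systems (hk : 0 < k) {ρ : Finset (Finset (Fin k))} (hρ : ρ ∈ parts (univ : Finset (Fin k)))
    (hgood : ρ ⊆ goodBlocks F c) : coreMap F c ρ ∈ systems F c ∧ fib (coreMap F c ρ) = ρ := by
  have hparts := mem_parts.1 hρ
  have hb : ∀ i, blockOf ρ i ∈ ρ ∧ i ∈ blockOf ρ i := fun i => blockOf_spec hρ (mem_univ i)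
  -- fibres of the core map are the blocks
  have hfib : ∀ i, fiber (coreMap F c ρ) i = blockOf ρ i := by
    intro i
    ext j
    rw [mem_fiber, coreMap, coreMap]
    constructor
    · intro h
      by_contra hj
      have hne' : blockOf ρ j ≠ blockOf ρ i := fun e => hj (e ▸ (hb j).2)
      exact (core_disjoint_of_good hup hne hρ hgood (hb j).1 (hb i).1 hne').2 h
    · intro hj
      rw [← eq_blockOf hρ (mem_univ j) (hb i).1 hj]
  refine ⟨mem_systems.2 ⟨fun i => ?_, fun i j => ?_, ?_⟩, ?_⟩
  · have := (mem_goodBlocks.1 (hgood (hb i).1)).2.1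
    exact (mem_FR.1 this).2 i (hb i).2
  · by_cases h : blockOf ρ i = blockOf ρ j
    · exact Or.inl (by rw [coreMap, coreMap, h])
    · exact Or.inr (core_disjoint_of_good hup hne hρ hgood (hb i).1 (hb j).1 h).1
  · -- cover: `⋃_i core (block i) = c`
    refine subset_antisymm (biUnion_subset.2 fun i _ => core_subset) fun x hx => ?_
    have hxu : x ∈ core F c (univ : Finset (Fin k)) := by rw [core_univ hcap]; exact hx
    rw [core_eq_biUnion hup univ ⟨⟨0, hk⟩, mem_univ _⟩, mem_biUnion] at hxu
    obtain ⟨i, -, hxi⟩ := hxu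
    exact mem_biUnion.2 ⟨i, mem_univ _, core_mono (singleton_subset_iff.2 (hb i).2) hxi⟩
  · -- the fibre partition is `ρ`
    ext R
    rw [fib, mem_image]
    constructor
    · rintro ⟨i, -, rfl⟩; rw [hfib]; exact (hb i).1
    · intro hR
      obtain ⟨i, hi⟩ := (hparts.1 R hR).1
      exact ⟨i, mem_univ _, by rw [hfib, ← eq_blockOf hρ (mem_univ i) hR hi]⟩

include hup hcap hne in
/-- **The number of admissible systems with fibre partition `ρ` is `1` if `ρ ⊆ goodBlocks`, else `0`** (`k ≥ 1`). [this work] -/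
theorem card_systems_fib_eq (hk : 0 < k) {ρ : Finset (Finset (Fin k))} (hρ : ρ ∈ parts (univ : Finset (Fin k))) :
    ((systems F c).filter fun γ => fib γ = ρ).card = if ρ ⊆ goodBlocks F c then 1 else 0 := by
  split_ifs with hgood
  · rw [card_eq_one]
    refine ⟨coreMap F c ρ, ?_⟩
    ext γ
    rw [mem_filter, mem_singleton]
    constructor
    · rintro ⟨hγ, hfibγ⟩
      rw [(eq_coreMap_of_mem_systems hup hcap hγ).1, hfibγ]
    · rintro rfl
      exact coreMap_mem_systems hup hcap hne hk hρ hgood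
  · rw [card_eq_zero]
    refine eq_empty_of_forall_notMem fun γ hγ => ?_
    rw [mem_filter] at hγ
    exact hgood (hγ.2 ▸ (eq_coreMap_of_mem_systems hup hcap hγ.1).2)

end Structure

/-! ### The leading coefficient in map language -/

/-- `Λ'(F) = Σ_{admissible γ} (−1)^{|im γ|+1} ∏_{a ∈ im γ} (occ γ a − 1)!`. [this work] -/
def LambdaSys (F : Fin k → Finset (Finset β)) (c : Finset β) : ℤ :=
  ∑ γ ∈ systems F c, (-1) ^ ((univ.image γ).card + 1) * ∏ a ∈ univ.image γ, (((occ γ a - 1).factorial : ℕ) : ℤ)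

omit [DecidableEq β] in
/-- The fibre map `a ↦ γ⁻¹(a)` is injective on the image, and the fibre partition is its image. [this work] -/
theorem fib_eq_image_image [DecidableEq β] (γ : Fin k → Finset β) :
    fib γ = (univ.image γ).image fun a => univ.filter fun j => γ j = a := by
  rw [fib, image_image]
  rfl

/-- The weight of a system depends only on its fibre partition:
`(−1)^{|im γ|+1} ∏_{a∈imγ} (occ a − 1)! = (−1)^{|fib γ|+1} ∏_{R ∈ fib γ} (|R| − 1)!`. [this work] -/
theorem weight_eq_of_fib (γ : Fin k → Finset β) :
    (-1 : ℤ) ^ ((univ.image γ).card + 1) * ∏ a ∈ univ.image γ, (((occ γ a - 1).factorial : ℕ) : ℤ) =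
      (-1) ^ ((fib γ).card + 1) * ∏ R ∈ fib γ, (((R.card - 1).factorial : ℕ) : ℤ) := by
  have hinj : Set.InjOn (fun a => univ.filter fun j => γ j = a) (univ.image γ : Set (Finset β)) := by
    intro a ha a' _ h
    obtain ⟨i, -, rfl⟩ := mem_image.1 (mem_coe.1 ha)
    have hi : i ∈ univ.filter fun j => γ j = γ i := mem_filter.2 ⟨mem_univ _, rfl⟩
    have h' : (univ.filter fun j => γ j = γ i) = univ.filter fun j => γ j = a' := h
    rw [h', mem_filter] at hi
    exact hi.2
  rw [fib_eq_image_image, card_image_of_injOn hinj, prod_image hinj]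
  rfl

section Main

variable {F : Fin k → Finset (Finset β)} {c : Finset β}
  (hup : ∀ i a a', a ∈ F i → a ⊆ a' → a' ⊆ c → a' ∈ F i)
  (hcap : ∀ a : Finset β, a ⊆ c → ((∀ i, a ∈ F i) ↔ a = c))
  (hne : ∀ i, ∅ ∉ F i)

include hup hcap hne in
/-- **`Λ'(F) = N_{goodBlocks}(𝟙)`** (`k ≥ 1`). [this work] -/
theorem LambdaSys_eq_N (hk : 0 < k) : LambdaSys F c = N (goodBlocks F c) (fun _ => 1) (univ : Finset (Fin k)) := by
  rw [LambdaSys, N]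
  rw [← sum_fiberwise_of_maps_to (s := systems F c) (t := parts (univ : Finset (Fin k))) (g := fib)
    (fun γ _ => fib_mem_parts γ)]
  rw [sum_filter]
  refine sum_congr rfl fun ρ hρ => ?_
  have hw : ∀ γ ∈ (systems F c).filter (fun γ => fib γ = ρ),
      (-1 : ℤ) ^ ((univ.image γ).card + 1) * ∏ a ∈ univ.image γ, (((occ γ a - 1).factorial : ℕ) : ℤ) =
        (-1) ^ (ρ.card + 1) * ∏ R ∈ ρ, bw (fun _ => 1) R := by
    intro γ hγ
    rw [mem_filter] at hγ
    rw [weight_eq_of_fib, hγ.2]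
    congr 1
    refine prod_congr rfl fun R _ => ?_
    rw [bw, sum_const, smul_eq_mul, mul_one]
  rw [sum_congr rfl hw, sum_const, card_systems_fib_eq hup hcap hne hk hρ, nsmul_eq_mul]
  split_ifs <;> simp

include hup hcap hne in
/-- **The leading sparse coefficient, in map language, is nonnegative**: `Λ'(F) ≥ 0` (`k ≥ 1`). [this work] -/
theorem LambdaSys_nonneg (hk : 0 < k) : 0 ≤ LambdaSys F c := by
  rw [LambdaSys_eq_N hup hcap hne hk]
  exact N_nonneg ⟨⟨0, hk⟩, mem_univ _⟩ (fun R _ => mem_powerset.2 (subset_univ R))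
    (fun A hA B hB => goodBlocks_union hup hA hB) (univ_mem_goodBlocks hcap hk) fun _ => le_rfl

end Main

end SahiSparseEnd

end Summit.CriticalPhenomena.PercolationContinuityZ3.Theorems
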